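import Mathlib
import Literature.Computability.Complexity.Circuit
import Literature.Computability.MetaComplexity.MCSP
import Literature.Computability.MetaComplexity.TruthTables
import Literature.Computability.MetaComplexity.ChenJinWilliams2020.ExplicitObstructions
import HarnessLib

/-!
# Hirahara–Santhanam 2017, Theorem 26: `MCSP[n^{1/(2√log n)}]` requires De Morgan formulas of size
# `n^{2−O(1/√log n)}` — the KNOWN side of census row R52 item 4 (`pub-magnif`)

Citation header. S. Hirahara, R. Santhanam, *On the Average-Case Complexity of MCSP and Its
Variants*, 32nd Computational Complexity Conference (CCC 2017), LIPIcs 79, 7:1–7:20,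
doi:10.4230/LIPIcs.CCC.2017.7 [bib: `HiraharaSanthanam2017`]; quoted from the proceedings PDF (held
key `paper:url-f29f90c23d6f`, 20 pp.; a locator `p. N Lk` is PDF page `N`, text line `k` of that copy).

Printed, verbatim (p. 11 L21–24): *"▶ Theorem 26. MCSP[s] requires a de Morgan formula of size
n^{2−O(1/√log n)} for s(n) = n^{1/(2√log n)}."* Conventions: (p. 5 L15–16) *"For convenience, we use
number of wires to measure circuit size."*; (p. 5 L40–44, Definition 6, `MCSP-C[s]`) *"Input. A string
y ∈ {0,1}^{2^n}, where n ∈ ℕ (inputs not of this form are rejected). Question. Does fn(y) have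
C-circuits of size at most s(n)?"*; (p. 11 L25–27) *"For a Boolean function f, L(f) denotes the
minimum size of a de Morgan formula that computes f."* In Theorem 26 and its proof (§4.2, p. 13) the
letter `n` is the INPUT LENGTH of the formula, i.e. the truth-table length (*"Let ρ : [n] → {0,1,∗} be
a restriction such that ρ can be computed by a circuit of size s"*, *"Hence, ρ ◦ σ is an YES instance
of MCSP[s]"*, Lemma 29, p. 13 L17–25), so at arity `m` (`n = 2^m`) the size parameter is
`s = n^{1/(2√log n)} = 2^{m/(2√m)} = 2^{√m/2}`; circuit sizes are integers, so `MCSP[s] = MCSP[⌊s⌋]`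
and the rounding in `param` is canonical.

What is typed here (all over existing tree declarations: `MCSPSize` = `MCSP[s]` on bare truth
tables with `circuitSizeOver B2`, `ChenJinWilliams2020.sliceFn` = the indicator of a language on
`{0,1}^N`, `ChenJinWilliams2020.deMorganFormulaFns b N` = the `N`-input functions with a De Morgan
formula of at most `b N` leaves — the class of the census's R52 item-4 threshold):
* `param m = ⌊2^{√m/2}⌋` — the printed size parameter at arity `m`;
* `bound c N = ⌊N^{2 − c/√(log₂ N)}⌋` — the printed leaf budget with the `O`-constant `c` explicit;
* `thm26` — **Theorem 26 as a named `Prop`** (cited; OPEN in the tree, used only as a hypothesis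
  `(hK : thm26)`): for some real `c`, at all large arities `m`, the `2^m`-slice of `MCSP[param]` is
  computed by NO De Morgan formula with at most `bound c (2^m)` leaves;
* PROVED: `thm26_delta` — the fixed-exponent consequence (*"MCSP[2^{√ℓ}] ∉ FML[n^{2−δ}] for all
  reals δ > 0 (where ℓ = log n)"* is how Atserias–Müller, arXiv:2503.24061 p. 3 Thm. 2, cite [HS17];
  the primary's parameter is `2^{√ℓ/2}`, recorded here as printed); `le_param` (`m ≤ param m` for
  `m ≥ 324`) and `param_le_two_pow_half` (`param m ≤ 2^{m/2}`) — the parameter lies in the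
  Chen–Jin–Williams regime `m ≤ s(m) ≤ 2^{(1−Ω(1))m}` of census row R52 from arity `324` on;
  `one_le_param`; `bound_lt_sq` (the budget is sub-quadratic for `c > 0`, `N ≥ 4`).

Modelling notes (recorded, not hidden). (1) Print measures circuit size by WIRES; the tree's
`MCSPSize` uses `circuitSizeOver B2`, the number of GATES of a fan-in-2 circuit over the full binary
basis. The printed proof touches the size measure only through (a) Lemma 29's count *"the number of
circuits of size at most s is s^{O(s)}"* (p. 13 L24–25; true for the gate count, cf. the tree's
`card_filter_circuitSizeOver_le`) and (b) *"the output of a composition of r q-regular l-wise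
independent random restrictions has circuit complexity at most s := poly(r, l, log n, log 1/q)"*
(p. 13 L5–8), polynomial in either measure (gates ≤ wires ≤ 2·gates at fan-in 2); the constant inside
`O(1/√log n)` absorbs the difference. The statement is nevertheless CITED here, not re-proved.
(2) "requires size `B`" (`L(f) ≥ B`) is rendered "not computable with `⌊B⌋` leaves", weaker by at most
one leaf, absorbed by `c`. (3) The `O`-constant is existential (`∃ c`), which is the content of
`n^{2−O(1/√log n)}` for all large `n`; no sign condition on `c` is needed for the consequences below.
-/

namespace Literature.Computability.MetaComplexity.HiraharaSanthanam2017

open Filter Literature.Computability.Complexity Literature.Computability.MetaComplexity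

/-! ### The printed parameter and budget -/

/-- The printed size parameter `s(n) = n^{1/(2√log n)}` at truth-table length `n = 2^m`, i.e.
`2^{√m/2}`, rounded down (canonical: circuit sizes are integers).
[cite: HiraharaSanthanam2017, Thm. 26 (parameter s)] -/
noncomputable def param (m : ℕ) : ℕ := ⌊(2 : ℝ) ^ (Real.sqrt m / 2)⌋₊

/-- The printed leaf budget `N^{2 − c/√(log₂ N)}` at input length `N` (the `O(1/√log n)` constant
made explicit as `c`), rounded down. [cite: HiraharaSanthanam2017, Thm. 26 (size bound)] -/
noncomputable def bound (c : ℝ) (N : ℕ) : ℕ :=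
  ⌊(N : ℝ) ^ (2 - c / Real.sqrt (Real.logb 2 N))⌋₊

/-! ### Theorem 26 (named fact) -/

/-- **Theorem 26** (Hirahara–Santhanam, CCC 2017, p. 11): *"MCSP[s] requires a de Morgan formula
of size n^{2−O(1/√log n)} for s(n) = n^{1/(2√log n)}."* Typed: for some constant `c`, for all large
arities `m`, the indicator of `MCSP[param]` on `{0,1}^{2^m}` has no De Morgan formula (basis
`{∧₂, ∨₂, ¬}`, fan-out `≤ 1`) with at most `⌊(2^m)^{2 − c/√m}⌋` leaves. OPEN in the tree — a
named `Prop`, never asserted. [cite: HiraharaSanthanam2017, Thm. 26] -/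
def thm26 : Prop :=
  ∃ c : ℝ, ∀ᶠ m : ℕ in atTop,
    ChenJinWilliams2020.sliceFn (MCSPSize param) (2 ^ m) ∉
      ChenJinWilliams2020.deMorganFormulaFns (bound c) (2 ^ m)

/-! ### Proved consequences and parameter facts -/

/-- `log₂ (2^m) = m` on the cast truth-table length. [folklore] -/
theorem logb_two_pow_length (m : ℕ) : Real.logb 2 ((2 ^ m : ℕ) : ℝ) = m := by
  rw [Nat.cast_pow, Nat.cast_ofNat, ← Real.rpow_natCast,
    Real.logb_rpow (by norm_num) (by norm_num)]

/-- Print's budget `N^{2−c/√log₂ N}` eventually dominates every fixed `N^{2−δ}` (`δ > 0`) along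
`N = 2^m`. [folklore] -/
theorem floor_rpow_le_bound (c : ℝ) {δ : ℝ} (hδ : 0 < δ) :
    ∀ᶠ m : ℕ in atTop, ⌊((2 ^ m : ℕ) : ℝ) ^ (2 - δ)⌋₊ ≤ bound c (2 ^ m) := by
  refine Filter.eventually_atTop.2 ⟨⌈(c / δ) ^ 2⌉₊ + 1, fun m hm => ?_⟩
  have hm1 : (1 : ℝ) ≤ m := by exact_mod_cast (show 1 ≤ m by omega)
  have hsqrt_pos : 0 < Real.sqrt m := Real.sqrt_pos.2 (by linarith)
  have hcd : c / Real.sqrt m ≤ δ := by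
    rw [div_le_iff₀ hsqrt_pos]
    by_cases hc : c ≤ 0
    · nlinarith [hsqrt_pos, hδ]
    · push Not at hc
      have hceil : (⌈(c / δ) ^ 2⌉₊ : ℝ) ≤ m := by
        exact_mod_cast (show ⌈(c / δ) ^ 2⌉₊ ≤ m by omega)
      have hm' : (c / δ) ^ 2 ≤ m := (Nat.le_ceil _).trans hceil
      have hcδ : 0 ≤ c / δ := div_nonneg hc.le hδ.le
      have hle : c / δ ≤ Real.sqrt m := (Real.le_sqrt hcδ (by positivity)).2 hm'
      rw [div_le_iff₀ hδ] at hle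
      linarith
  unfold bound
  rw [logb_two_pow_length]
  apply Nat.floor_le_floor
  have h1 : (1 : ℝ) ≤ ((2 ^ m : ℕ) : ℝ) := by exact_mod_cast Nat.one_le_two_pow
  exact Real.rpow_le_rpow_of_exponent_le h1 (by linarith)

/-- **Fixed-exponent form of Theorem 26**: given the fact, for every real `δ > 0`, at all large
arities `m` the `2^m`-slice of `MCSP[⌊2^{√m/2}⌋]` has no De Morgan formula with `⌊(2^m)^{2−δ}⌋`
leaves. [cite: HiraharaSanthanam2017, Thm. 26 (consequence)] -/
theorem thm26_delta (h : thm26) {δ : ℝ} (hδ : 0 < δ) :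
    ∀ᶠ m : ℕ in atTop, ChenJinWilliams2020.sliceFn (MCSPSize param) (2 ^ m) ∉
      ChenJinWilliams2020.deMorganFormulaFns (fun N => ⌊(N : ℝ) ^ (2 - δ)⌋₊) (2 ^ m) := by
  obtain ⟨c, hc⟩ := h
  filter_upwards [hc, floor_rpow_le_bound c hδ] with m hm hle
  exact fun hmem => hm (ChenJinWilliams2020.deMorganFormulaFns_mono
    (s := fun N : ℕ => ⌊(N : ℝ) ^ (2 - δ)⌋₊) (s' := bound c) hle hmem)

/-- `(2j+2)² ≤ 2^j` for `j ≥ 9`. [folklore] -/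
theorem sq_le_two_pow_aux {j : ℕ} (hj : 9 ≤ j) : (2 * j + 2) ^ 2 ≤ 2 ^ j := by
  induction j, hj using Nat.le_induction with
  | base => norm_num
  | succ j hj ih =>
    have h1 : (2 * (j + 1) + 2) ^ 2 ≤ 2 * (2 * j + 2) ^ 2 := by nlinarith
    calc (2 * (j + 1) + 2) ^ 2 ≤ 2 * (2 * j + 2) ^ 2 := h1
      _ ≤ 2 * 2 ^ j := Nat.mul_le_mul_left 2 ih
      _ = 2 ^ (j + 1) := by rw [pow_succ']

/-- `(k+1)² ≤ 2^{⌊k/2⌋}` for `k ≥ 18`. [folklore] -/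
theorem succ_sq_le_two_pow_half {k : ℕ} (hk : 18 ≤ k) : (k + 1) ^ 2 ≤ 2 ^ (k / 2) := by
  have hj : 9 ≤ k / 2 := by omega
  have hk' : k + 1 ≤ 2 * (k / 2) + 2 := by omega
  calc (k + 1) ^ 2 ≤ (2 * (k / 2) + 2) ^ 2 := Nat.pow_le_pow_left hk' 2
    _ ≤ 2 ^ (k / 2) := sq_le_two_pow_aux hj

/-- From arity `324` on the printed parameter satisfies the lower constraint `m ≤ s(m)` of the
Chen–Jin–Williams regime: `m ≤ ⌊2^{√m/2}⌋`. [folklore] -/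
theorem le_param {m : ℕ} (hm : 324 ≤ m) : m ≤ param m := by
  have hk18 : 18 ≤ Nat.sqrt m := by rw [Nat.le_sqrt]; omega
  have hlt : m < 2 ^ (Nat.sqrt m / 2) :=
    lt_of_lt_of_le (Nat.lt_succ_sqrt' m) (succ_sq_le_two_pow_half hk18)
  have hkle : (Nat.sqrt m : ℝ) ≤ Real.sqrt m := by
    rw [Real.le_sqrt (Nat.cast_nonneg _) (Nat.cast_nonneg _)]
    exact_mod_cast Nat.sqrt_le' m
  have hexp : ((Nat.sqrt m / 2 : ℕ) : ℝ) ≤ Real.sqrt m / 2 := by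
    have : ((Nat.sqrt m / 2 : ℕ) : ℝ) ≤ (Nat.sqrt m : ℝ) / 2 := Nat.cast_div_le
    linarith
  have hpow : ((2 ^ (Nat.sqrt m / 2) : ℕ) : ℝ) ≤ (2 : ℝ) ^ (Real.sqrt m / 2) := by
    rw [Nat.cast_pow, Nat.cast_ofNat, ← Real.rpow_natCast]
    exact Real.rpow_le_rpow_of_exponent_le (by norm_num) hexp
  have : 2 ^ (Nat.sqrt m / 2) ≤ param m := Nat.le_floor hpow
  omega

/-- The printed parameter is at most `2^{m/2}`, inside the upper constraint `s(m) ≤ 2^{(1−Ω(1))m}`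
of the Chen–Jin–Williams regime (with the constant `1/2`). [folklore] -/
theorem param_le_two_pow_half (m : ℕ) : (param m : ℝ) ≤ (2 : ℝ) ^ ((1 / 2 : ℝ) * m) := by
  have h0 : (0 : ℝ) ≤ (2 : ℝ) ^ (Real.sqrt m / 2) := by positivity
  refine (Nat.floor_le h0).trans (Real.rpow_le_rpow_of_exponent_le (by norm_num) ?_)
  have hm : (m : ℝ) ≤ (m : ℝ) ^ 2 := by exact_mod_cast Nat.le_self_pow two_ne_zero m
  have hs : Real.sqrt m ≤ m :=
    (Real.sqrt_le_sqrt hm).trans_eq (Real.sqrt_sq (Nat.cast_nonneg m))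
  linarith

/-- The printed parameter is at least `1` (`2^{√m/2} ≥ 1`). [folklore] -/
theorem one_le_param (m : ℕ) : 1 ≤ param m := by
  refine Nat.le_floor ?_
  rw [Nat.cast_one]
  exact Real.one_le_rpow (by norm_num) (by positivity)

/-- The budget of Theorem 26 is sub-quadratic: `⌊N^{2−c/√log₂ N}⌋ < N²` for `c > 0`, `N ≥ 4`.
[folklore] -/
theorem bound_lt_sq {c : ℝ} (hc : 0 < c) {N : ℕ} (hN : 4 ≤ N) : bound c N < N ^ 2 := by
  have hN1 : (1 : ℝ) < N := by exact_mod_cast (show 1 < N by omega)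
  have h4 : (4 : ℝ) ≤ N := by exact_mod_cast hN
  have hlog4 : Real.logb 2 (4 : ℝ) = 2 := by
    rw [show (4 : ℝ) = 2 ^ (2 : ℕ) by norm_num, Real.logb_pow, Real.logb_self_eq_one one_lt_two]
    norm_num
  have h2 : (2 : ℝ) ≤ Real.logb 2 N := by
    have h := Real.logb_le_logb_of_le one_lt_two (by norm_num) h4
    rwa [hlog4] at h
  have hL : 0 < Real.sqrt (Real.logb 2 N) := Real.sqrt_pos.2 (by linarith)
  have hexp : 2 - c / Real.sqrt (Real.logb 2 N) < 2 := by
    have := div_pos hc hL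
    linarith
  have hlt : (N : ℝ) ^ (2 - c / Real.sqrt (Real.logb 2 N)) < (N : ℝ) ^ (2 : ℝ) :=
    Real.rpow_lt_rpow_of_exponent_lt hN1 hexp
  have hcast : (N : ℝ) ^ (2 : ℝ) = ((N ^ 2 : ℕ) : ℝ) := by
    rw [Nat.cast_pow, ← Real.rpow_natCast]; norm_num
  unfold bound
  rw [← Nat.cast_lt (α := ℝ)]
  refine lt_of_le_of_lt (Nat.floor_le (by positivity)) ?_
  rw [← hcast]; exact hlt

end Literature.Computability.MetaComplexity.HiraharaSanthanam2017
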